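import Mathlib
import Summits.Ventures.FusionMHD.Models.CerfonFreidbergIterLikeQHalfResDefs
import HarnessLib

/-!
# Ventures/FusionMHD — Models/CerfonFreidbergIterLikeQHalfResPanels14.lean: KERNEL CHECK of the resistive-register certificates of panel(s) 24, 25 (of 32)
# at `ψ_N = 1/2` of THE Cerfon–Freidberg ITER-like instance

HONEST FRAMING (LADDER-GRIDFUSION three columns; CF rung; rider «D_R at ψ_N = 1/2»).  One `decide +kernel` (≈ 60–90 s): for each listed panel the obligation
`CFIterLike.QHalfRes.ResCert.ok` (`Models/CerfonFreidbergIterLikeQHalfResDefs.lean`) — the Taylor-model run of `progR = progM ++ block3R` over ★ #117's parameter box is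
ACCEPTED and the kernel's two panel-integral enclosures (`g_AG`, `g_W` along the approximant) lie inside the claimed integers (compiled `#eval` of the same functions, slack
one unit of `2⁻⁶⁰`; float truth inside every panel, `genqm/truthR.json`).  MODELLED: analytic Cerfon–Freidberg family; nothing about a device or stability.
No `native_decide`.  Typer/prover: gridfusion-model-7 (g7), 2026-08-28.  Citations: Zheng 2015 §3.2 (3.42) [Zheng2015];
Mahboubi–Melquiond–Sibut-Pinote 2016 §3.2 Lemma 3 [MahboubiMelquiondSibutpinote2016].
-/

namespace Summit.Ventures.FusionMHD.Models.CFIterLike.QHalfRes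

/-- Resistive-register certificate data of panel(s) 24, 25. [instance data] -/
def resCert14 : List ResCert := [
  { j := 24, cand1 := [1463646959398530318336, -7755099614427718090752, 27286920670344118272000, 20821693097346288582656, -807559625373298318114816, 5491198354573334316843008, -20288189112968847118303232, 15154677928072650071998464, 379184759197883391218286592, -3145721365307438584121262080, 12639121353689281366465708032, 6359380090332347689563324416, 1245521228079358214858742956032],
    cand2 := [962725259590362595328, -4361744835855696003072, 23008953505064796815360, -81061800512795946516480, 152134217299146458529792, 790096326560969100623872, -10950479353093950906826752, 77232865659096130195030016, -404656250958529850175913984, 1609045770974242144063062016, -4069528499935879788484362240, 211129266635809792328728576, 70845068027436582508007784448],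
    deg := 10, e1 := 45, e2 := 44, glo := 5327328801594674, ghi := 5327329178161871, wlo := 263886500763511648, whi := 263886517969197313 },
  { j := 25, cand1 := [1247958222408858992640, -6064523789309664296960, 25909319139113138388992, -37944155204078247346176, -214610290263967433490432, 2360107064167544871976960, -12288638865522719297896448, 40788352835454269942398976, -48580553183549356593119232, -414756394087494327417700352, 3353866776962594597767217152, -53086948918853663684913266688, 842424363666913693226932109312],
    cand2 := [846576961496368021504, -3140369216191773802496, 16424598573182613454848, -58998268998348011732992, 175928508483769517211648, -206969921679605284995072, -1776349117900586861199360, 18594394160454205723115520, -114605024706694088476327936, 579600419051669144257691648, -2425252380042350792535965696, -25112917196796383712161824768, 357316188163944001146988789760],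
    deg := 10, e1 := 44, e2 := 44, glo := 5229052521686427, ghi := 5229052762074884, wlo := 235096924693404366, whi := 235096934409994793 }]

/-- **KERNEL CHECK** of the two resistive registers on panel(s) 24, 25. -/
theorem resCert14_ok : CFIterLike.QHalfRes.resCert14.all ResCert.ok = true := by
  decide +kernel

end Summit.Ventures.FusionMHD.Models.CFIterLike.QHalfRes
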